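import Mathlib
import Summits.KontsevichZagierPeriods.Zeta5Search.ThirdOrderDigit
import Summits.KontsevichZagierPeriods.Zeta5Search.ResidueLaw
import HarnessLib

/-!
# ζ(5) search — THEOREM A⁗ (`LawA4`) on the record ray near `θ = 1`: the DEG-free windows (gen-2 g12)

Cell `pub-zeta5` (HONEST FRAMING: systematic search; no irrationality claim unless certified), ideation seat gen-2, generation 12
(`HOME/pub-zeta5-gen-2/REPORT-gen2-g12.md`).  INCREMENT over the tree's `Zeta5Search/ThirdOrderDigit.lean` (p235436: `LawA4` = THEOREM A⁗,
`v_p(Cas_j) ≥ 7 − 2M`, PROVED ON PAPER in REPORT-gen2-g10 §6, no DEG hypothesis) and `Zeta5Search/ResidueLaw.lean` (p237302: the seven DEG windows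
of gen-2 g11).  New namespace, nothing redeclared; STATEMENTS (`@[conjecture] def … : Prop`) plus three PROVED reductions.

WHAT IS NEW (REPORT-gen2-g12 §2).  gen-2 g11 closed the census gap on the seven record windows where the degree condition DEG holds and declared the
cluster of gap windows at `θ = p/n ≈ 1` (and its copies at `θ ≈ 1/2, 1/3, 1/4`) "DEG-dead".  They are not dead: there the class structure of
`b(n) = bRec n` is the ONE-TYPE structure of THEOREM A⁗ — every class of the minimal even exponent `−M` has the palindromic type list `T_M`
below, every class of exponent `−M+1` is a single raise of `T_M`, every class of exponent `−M+2` an admissible double raise — so `LawA4` gives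
`v_p(Cas₇(b(n))) ≥ 7 − 2M = casLB + 4` with NO degree condition (census: proved `casLB + 2` there).  Moreover `LawA4` does not require that a
class of exponent `−M` exists: on the windows where the minimal multipole exponent `m` is ODD (`θ ∈ (1, 41/40]`, `(17/18, 41/43]`, `(19/18, 18/17]`,
the lattice layers, `p = n`, …) the SHIFTED frame `M := 1 − m`, `T := T_M` satisfies the hypotheses (the deep classes are the end-raises `1 :: T`,
`T ++ [1]`; the classes of exponent `m + 1` are admissible double raises), giving `casLB + 2` where the census has the origin-regime `casLB + 1`.  Per-instance verification of the five class clauses of `LawA4` for `b(n)` (and, for information, `b(n)+e₇`):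
`HOME/pub-zeta5-gen-2/g12/hypA4scan.py`, `hypA4shift.py`, `winscanA4s.py` (logs `hypA4_094_114.txt`, `winscanA4s_span45.txt`, `merged_*.txt`):
every window prime of the three windows below with `n ≤ 150` (124 + 111 + 54 instances), 0 exceptions — lattice layers and `p = n` included (shifted frame).

CONTENTS.  `T56`, `T52`, `T48` (the deep palindromes); `LawA4Classes b p M T` (the five class clauses of `LawA4`, verbatim); the class-structure
statements `RecClassesM56/M52/M48` (decidable per instance; the cell-uniform proofs are class bookkeeping in the scale-free coordinates
`u = k/n`, `θ = p/n`, REPORT §2.4); the window bounds `RecWindowM56` (−105), `RecWindowM52` (−97), `RecWindowM48` (−89); and the PROVED reductions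
`recWindowM56_of`, `recWindowM52_of`, `recWindowM48_of` : `LawA4 → RecClassesM.. → RecWindowM..`.
-/

open Finset

namespace Summit.KontsevichZagierPeriods.Zeta5Search.RecordWindowsA4

open Summit.KontsevichZagierPeriods.Zeta5Search.ClusterValuation
open Summit.KontsevichZagierPeriods.Zeta5Search.CasoratianValuation (InPolytope shift casoratian)
open Summit.KontsevichZagierPeriods.Zeta5Search.SecondOrder (classTypeList isRaise isRaise2 LawA4)

/-! ## §1 The deep palindromes and the class clauses of `LawA4` -/

/-- Deep type on `θ ∈ (18/19, 1)` (`M = 56`, length 42): `[1×11, 0, −1, …, −5, −6×8, −5, …, −1, 0, 1×11]`. -/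
def T56 : List ℤ := [1, 1, 1, 1, 1, 1, 1, 1, 1, 1, 1, 0, -1, -2, -3, -4, -5, -6, -6, -6, -6, -6, -6, -6, -6, -5, -4, -3, -2, -1, 0, 1, 1, 1, 1, 1, 1, 1, 1, 1, 1, 1]

/-- Deep type on `θ ∈ (1, 18/17]`-part with `M = 52` (length 39): `[1×10, 0, −1, …, −5, −6×7, −5, …, 0, 1×10]`. -/
def T52 : List ℤ := [1, 1, 1, 1, 1, 1, 1, 1, 1, 1, 0, -1, -2, -3, -4, -5, -6, -6, -6, -6, -6, -6, -6, -5, -4, -3, -2, -1, 0, 1, 1, 1, 1, 1, 1, 1, 1, 1, 1]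

/-- Deep type with `M = 48` (length 36): `[1×9, 0, −1, …, −5, −6×6, −5, …, 0, 1×9]`. -/
def T48 : List ℤ := [1, 1, 1, 1, 1, 1, 1, 1, 1, 0, -1, -2, -3, -4, -5, -6, -6, -6, -6, -6, -6, -5, -4, -3, -2, -1, 0, 1, 1, 1, 1, 1, 1, 1, 1, 1]

/-- `T56` is palindromic. -/
theorem T56_reverse : T56.reverse = T56 := by decide
/-- `T52` is palindromic. -/
theorem T52_reverse : T52.reverse = T52 := by decide
/-- `T48` is palindromic. -/
theorem T48_reverse : T48.reverse = T48 := by decide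

/-- The five CLASS CLAUSES of `SecondOrder.LawA4` for `(b, p, M, T)`, verbatim: multipole classes have exponent `≥ −M`; single-pole classes have
`ν ≥ −M+1`; every multipole class of exponent `−M` is centre-free with type list `T`; every pole class with `ν = −M+1` is a single raise of `T`
(or the odd-centre class of list `T`); every pole class with `ν = −M+2` is an admissible double raise of `T`.  (No clause asks that a class of
exponent `−M` exists — the shifted frames of §2 use this.) -/
def LawA4Classes (b : ℕ → ℤ) (p M : ℕ) (T : List ℤ) : Prop :=
  (∀ x ∈ multipoleClasses b p, -(M : ℤ) ≤ classExp b p x) ∧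
  (∀ y, y < p → classPoleCount b p y = 1 → -(M : ℤ) + 1 ≤ classNu b p y) ∧
  (∀ x ∈ multipoleClasses b p, classExp b p x = -(M : ℤ) → ¬ CentreIn b p x ∧ classTypeList b p x = T) ∧
  (∀ y, y < p → 1 ≤ classPoleCount b p y → classNu b p y = -(M : ℤ) + 1 →
      isRaise T (classTypeList b p y) = true ∨ (¬ (2 : ℤ) ∣ b 0 ∧ CentreIn b p y ∧ classTypeList b p y = T)) ∧
  (∀ z, z < p → 1 ≤ classPoleCount b p z → classNu b p z = -(M : ℤ) + 2 → isRaise2 T (classTypeList b p z) = true)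

/-- `LawA4` applied through `LawA4Classes` (bookkeeping). -/
theorem lawA4_apply (hA : LawA4) (b : ℕ → ℤ) (p j M : ℕ) (T : List ℤ)
    (hb : InPolytope b) (hbj : InPolytope (shift b j)) (hj1 : 1 ≤ j) (hj7 : j ≤ 7) (hp : p.Prime) (h5 : 5 ≤ p)
    (hpb : (p : ℤ) ≤ b 0) (hp2 : (b 0 + 2 : ℤ) < (p : ℤ) ^ 2) (hM : 6 ≤ M) (hE : Even M) (hT : T.reverse = T)
    (hC : LawA4Classes b p M T) (hne : casoratian b j ≠ 0) :
    (7 : ℤ) - 2 * M ≤ padicValRat p (casoratian b j) := by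
  obtain ⟨c1, c2, c3, c4, c5⟩ := hC
  exact hA b p j M T hb hbj hj1 hj7 hp h5 hpb hp2 hM hE hT c1 c2 c3 c4 c5 hne

/-! ## §2 The record-ray class structure near `θ = 1` (decidable per instance; verified at every window prime with `n ≤ 150`) -/

/-- **CLASS STRUCTURE, frame `M = 56`** on `17n < 18p`, `p ≤ n` (`θ = p/n ∈ (17/18, 1]`): the `LawA4` clauses hold for `bRec n` with `M = 56`,
`T = T56`.  On `43p ≥ 41n + 3`, `p < n` the minimal multipole exponent is `−56` (DIRECT frame: the deep classes have type `T56`); on the lattice layer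
`43p − 41n ∈ {1, 2}`, at `p = n`, and on `17n < 18p`, `43p ≤ 41n` it is `−55` and the frame is the SHIFTED one (no class of exponent `−56`; the deep
classes are the end-raises `1 :: T56`, `T56 ++ [1]`).  Verified: all 124 window primes with `42 ≤ n ≤ 150` (`g12/merged_M56.txt`). -/
@[conjecture] def RecClassesM56 : Prop :=
  ∀ n p : ℕ, 2 ≤ n → p.Prime → 17 * n < 18 * p → p ≤ n → 41 * n + 2 < p ^ 2 → LawA4Classes (bRec n) p 56 T56

/-- **CLASS STRUCTURE, frame `M = 52`** on `n < p`, `17p ≤ 18n` (`θ ∈ (1, 18/17]`): the `LawA4` clauses hold for `bRec n` with `M = 52`,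
`T = T52` (direct frame — minimal exponent `−52` — on `(41/40, 19/18]` off its end layers, shifted frame — minimal exponent `−51` — on `(1, 41/40]`,
`(19/18, 18/17]` and the layers).  Verified: all 111 window primes with `42 ≤ n ≤ 150` (`g12/merged_M52.txt`). -/
@[conjecture] def RecClassesM52 : Prop :=
  ∀ n p : ℕ, 2 ≤ n → p.Prime → n < p → 17 * p ≤ 18 * n → 41 * n + 2 < p ^ 2 → LawA4Classes (bRec n) p 52 T52

/-- **CLASS STRUCTURE, frame `M = 48`** on `11n < 10p`, `8p ≤ 9n` (`θ ∈ (11/10, 9/8]`): the `LawA4` clauses hold for `bRec n` with `M = 48`,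
`T = T48` (direct frame — minimal exponent `−48` — on `(41/37, 19/17]` off its layers, shifted — `−47` — on `(11/10, 41/37]`, `(19/17, 9/8]` and the
layers).  Verified: all 54 window primes with `34 ≤ n ≤ 150` (`g12/merged_M48.txt`). -/
@[conjecture] def RecClassesM48 : Prop :=
  ∀ n p : ℕ, 2 ≤ n → p.Prime → 11 * n < 10 * p → 8 * p ≤ 9 * n → 41 * n + 2 < p ^ 2 → LawA4Classes (bRec n) p 48 T48

/-! ## §3 The window bounds (`= 7 − 2M`; census: what-if rungs, REPORT §3) -/

/-- **RECORD WINDOW `M = 56`** (`θ ∈ (17/18, 1]`): `v_p(Cas₇(b(n))) ≥ −105` (census proved column: `−107` on `(41/43, 1)`, `−106` on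
`(17/18, 41/43]`; Brown–Zudilin what-if truth `−105` on `(25/26, 1)`, `−104` on `(18/19, 25/26]`). -/
@[conjecture] def RecWindowM56 : Prop :=
  ∀ n p : ℕ, 2 ≤ n → p.Prime → 17 * n < 18 * p → p ≤ n → 41 * n + 2 < p ^ 2 →
    casoratian (bRec n) 7 ≠ 0 → (-105 : ℤ) ≤ padicValRat p (casoratian (bRec n) 7)

/-- **RECORD WINDOW `M = 52`** (`θ ∈ (1, 18/17]`): `v_p(Cas₇(b(n))) ≥ −97` (census proved column `−99` (even part) / `−98` (odd part)). -/
@[conjecture] def RecWindowM52 : Prop :=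
  ∀ n p : ℕ, 2 ≤ n → p.Prime → n < p → 17 * p ≤ 18 * n → 41 * n + 2 < p ^ 2 →
    casoratian (bRec n) 7 ≠ 0 → (-97 : ℤ) ≤ padicValRat p (casoratian (bRec n) 7)

/-- **RECORD WINDOW `M = 48`** (`θ ∈ (11/10, 9/8]`): `v_p(Cas₇(b(n))) ≥ −89` (census proved column `−91` (even part) / `−90` (odd part)). -/
@[conjecture] def RecWindowM48 : Prop :=
  ∀ n p : ℕ, 2 ≤ n → p.Prime → 11 * n < 10 * p → 8 * p ≤ 9 * n → 41 * n + 2 < p ^ 2 →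
    casoratian (bRec n) 7 ≠ 0 → (-89 : ℤ) ≤ padicValRat p (casoratian (bRec n) 7)

/-! ## §4 The reductions (PROVED): `LawA4` + class structure ⇒ window bound -/

/-- A window prime with `p² > 41n+2`, `n ≥ 2` is at least `5`. -/
private theorem five_le_of_sq (n p : ℕ) (hn : 2 ≤ n) (h : 41 * n + 2 < p ^ 2) : 5 ≤ p := by
  by_contra hc
  have hp4 : p ≤ 4 := by omega
  have : p ^ 2 ≤ 4 ^ 2 := Nat.pow_le_pow_left hp4 2
  omega

/-- `b₀` of the record ray is `41n`. -/
private theorem bRec_zero' (n : ℕ) : bRec n 0 = 41 * (n : ℤ) := by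
  simp [bRec]; ring

/-- **Reduction (PROVED)**: `LawA4` and the class structure `RecClassesM56` give the window bound `RecWindowM56` (`−105`). -/
theorem recWindowM56_of (hA : LawA4) (hS : RecClassesM56) : RecWindowM56 := by
  intro n p hn hp h1 h2 h3 hne
  have hC := hS n p hn hp h1 h2 h3
  have h5 : 5 ≤ p := five_le_of_sq n p hn h3
  have hpb : (p : ℤ) ≤ bRec n 0 := by rw [bRec_zero']; exact_mod_cast (by omega : p ≤ 41 * n)
  have hp2 : (bRec n 0 + 2 : ℤ) < (p : ℤ) ^ 2 := by rw [bRec_zero']; exact_mod_cast (by omega : 41 * n + 2 < p ^ 2)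
  have key := lawA4_apply hA (bRec n) p 7 56 T56 (inPolytope_bRec n) (inPolytope_shift_bRec n 7 (by omega) (by norm_num) (by norm_num))
    (by norm_num) (by norm_num) hp h5 hpb hp2 (by norm_num) (by decide) T56_reverse hC hne
  have e : (7 : ℤ) - 2 * ((56 : ℕ) : ℤ) = -105 := by norm_num
  rw [e] at key; exact key

/-- **Reduction (PROVED)**: `LawA4` and the class structure `RecClassesM52` give the window bound `RecWindowM52` (`−97`). -/
theorem recWindowM52_of (hA : LawA4) (hS : RecClassesM52) : RecWindowM52 := by
  intro n p hn hp h1 h2 h3 hne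
  have hC := hS n p hn hp h1 h2 h3
  have h5 : 5 ≤ p := five_le_of_sq n p hn h3
  have hpb : (p : ℤ) ≤ bRec n 0 := by rw [bRec_zero']; exact_mod_cast (by omega : p ≤ 41 * n)
  have hp2 : (bRec n 0 + 2 : ℤ) < (p : ℤ) ^ 2 := by rw [bRec_zero']; exact_mod_cast (by omega : 41 * n + 2 < p ^ 2)
  have key := lawA4_apply hA (bRec n) p 7 52 T52 (inPolytope_bRec n) (inPolytope_shift_bRec n 7 (by omega) (by norm_num) (by norm_num))
    (by norm_num) (by norm_num) hp h5 hpb hp2 (by norm_num) (by decide) T52_reverse hC hne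
  have e : (7 : ℤ) - 2 * ((52 : ℕ) : ℤ) = -97 := by norm_num
  rw [e] at key; exact key

/-- **Reduction (PROVED)**: `LawA4` and the class structure `RecClassesM48` give the window bound `RecWindowM48` (`−89`). -/
theorem recWindowM48_of (hA : LawA4) (hS : RecClassesM48) : RecWindowM48 := by
  intro n p hn hp h1 h2 h3 hne
  have hC := hS n p hn hp h1 h2 h3
  have h5 : 5 ≤ p := five_le_of_sq n p hn h3
  have hpb : (p : ℤ) ≤ bRec n 0 := by rw [bRec_zero']; exact_mod_cast (by omega : p ≤ 41 * n)
  have hp2 : (bRec n 0 + 2 : ℤ) < (p : ℤ) ^ 2 := by rw [bRec_zero']; exact_mod_cast (by omega : 41 * n + 2 < p ^ 2)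
  have key := lawA4_apply hA (bRec n) p 7 48 T48 (inPolytope_bRec n) (inPolytope_shift_bRec n 7 (by omega) (by norm_num) (by norm_num))
    (by norm_num) (by norm_num) hp h5 hpb hp2 (by norm_num) (by decide) T48_reverse hC hne
  have e : (7 : ℤ) - 2 * ((48 : ℕ) : ℤ) = -89 := by norm_num
  rw [e] at key; exact key

end Summit.KontsevichZagierPeriods.Zeta5Search.RecordWindowsA4
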